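import Literature.Topology.FourManifolds.BandCore
import Literature.Topology.FourManifolds.BandLoopGerms
import Literature.Topology.FourManifolds.BandThickening
import Literature.Topology.FourManifolds.FlatteningChart
import HarnessLib

/-!
# The band in the tube of the core loop: a band core between two knots crossed by an
# auxiliary embedded circle

Topic `Literature/Topology/FourManifolds` (trunk T-4MAN); fact seat
`provefact-Literature.Topology.FourManifolds.Knot.exists_isBandSum` (`BandSum.lean`: existence of
band sums, R. E. Gompf, A. I. Stipsicz, *4-Manifolds and Kirby Calculus* (1999), §5.1, Fig. 5.7;
R. C. Kirby, *The Topology of 4-Manifolds* (1989), Ch. I §4, p. 10: "the band-connected sum can be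
done along any band").

**The theorem** (`Literature.Topology.FourManifolds.Knot.nonempty_bandCore_of_loop`).  Let `K₁`,
`K₂` be knots and `E` an auxiliary knot (smoothly embedded circle) which passes through
`K₁ (circlePoint θ₁)` at the angle `0` and through `K₂ (circlePoint θ₂)` at the angle `π`, meets
`K₁` and `K₂` in no other points, crosses both transversally (the velocity of `Kᵢ` at the crossing
is not a multiple of that of `E`), and lies in an open set `U`.  Then there is a band core
`BandCore K₁ K₂ Uᶜ` (`BandCore.lean`: a smooth map `ℝ² → 𝕊³`, an injective immersion on the collar
square missing `Uᶜ`, meeting `K₁` exactly in its left edge line traversed upwards and `K₂` exactly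
in its right edge line traversed downwards).  With `BandCore.exists_isBandSum`
(`BandCoreRebuild.lean`) this is a band sum of `K₁` and `K₂`; the core loop itself is produced in
`BandCoreLoop.lean` (`exists_coreLoop`) from a path between the knots off the avoided set.

**The construction.**  Everything is written in the tubular coordinates
`T = E.tubularMap : 𝕊¹ × ℝ² → 𝕊³` of `E` (a smooth embedding, `DehnSurgeryTubularNbhdProofs.lean`).
By `SphereEmbedding.exists_edgeGerm` (`BandLoopGerms.lean`) the arcs of `K₁`, `K₂` through the
crossings are `y ↦ T (circlePoint (φ₁ y), w₁ y)` and `y ↦ T (circlePoint (π + φ₂ y), w₂ y)`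
(the second traversed backwards) with `wᵢ' (0) ≠ 0`.  The band is

  `band (x₀, x₁) = T (circlePoint Φ, W)`,  `ỹ = κ (x₁ - 1/2)`,
  `Φ = π x₀ + β x₀ · φ₁ ỹ + β (1 - x₀) · φ₂ ỹ`,
  `W = β x₀ · w₁ ỹ + β (1 - x₀) · w₂ ỹ + (1 - β x₀ - β (1 - x₀)) ỹ · v x₀`,

where `β` is a smooth cut-off equal to `1` near `0` and `0` beyond `1/4`, and `v` is a smooth
nowhere-zero planar field rotating `w₁' 0` into `w₂' 0` (`exists_rotating_field`): along the core
`x₁ = 1/2` the band is the arc of `E` from the first crossing to the second, its left edge line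
`x₀ = 0` is the arc of `K₁` (upwards) and its right edge line `x₀ = 1` the arc of `K₂`
(downwards), and in between the `x₁`-direction is a nonzero normal displacement.  For `κ` small:

* the coordinate map `(x₀, y) ↦ (Φ, W)` is injective and immersive on a uniform strip about the
  core (`exists_strip_injOn_coords`: injective differential along the core, local injectivity of
  immersions `exists_mem_nhds_injOn_of_hasStrictFDerivAt`, the compactness lemma
  `exists_injOn_prod_ball_of_isCompact` of `BandThickening.lean`, and
  `exists_forall_injective_fderiv_near`), so `band` is an injective immersion on the collar square
  (`T` is an embedding, `E.tubeδ` has injective differential);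
* a thin tube about `E` lies in `U` and meets `Kᵢ` only near the crossings
  (`exists_forall_tubularMap_mem`, `exists_radius_tube_inter_range`), where the explicit
  coordinates and the injectivity of `wᵢ` near `0` show that the band meets `K₁` exactly for
  `x₀ = 0` and `K₂` exactly for `x₀ = 1`;
* the orientation clauses are read off the edge lines, which are `K₁ (circlePoint (θ₁ + κ (x₁ -
  1/2)))` and `K₂ (circlePoint (θ₂ - κ (x₁ - 1/2)))` on the nose.

Everything here is proved; no named facts are introduced.

## References

* R. E. Gompf, A. I. Stipsicz, *4-Manifolds and Kirby Calculus*, GSM 20, AMS (1999), §5.1,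
  Fig. 5.7. [GompfStipsicz1999]
* R. C. Kirby, *The Topology of 4-Manifolds*, LNM 1374, Springer (1989), Ch. I §4, p. 10 (held:
  `book:kirby1989-topology-4-manifolds`, PDF p. 10). [Kirby1989]
* M. W. Hirsch, *Differential Topology*, GTM 33 (1976), Ch. 4 §5 (tubular neighbourhoods).
  [Hirsch1976]
-/

open scoped Manifold ContDiff Topology RealInnerProductSpace Real
open Function Set Filter Metric

noncomputable section

namespace Literature.Topology.FourManifolds

/-- Local notation: `𝔼 n` is the model Euclidean space `EuclideanSpace ℝ (Fin n)`. -/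
local notation "𝔼 " n:arg => EuclideanSpace ℝ (Fin n)

/-- Local notation: `𝕊 n` is the unit sphere in `EuclideanSpace ℝ (Fin (n + 1))`. -/
local notation "𝕊 " n:arg => (Metric.sphere (0 : EuclideanSpace ℝ (Fin (n + 1))) 1)

/-- Local notation: the model with corners of `𝕊¹ × ℝ²`. -/
local notation "𝓘₁₂" => (ModelWithCorners.prod (𝓡 1) 𝓘(ℝ, EuclideanSpace ℝ (Fin 2)))

attribute [local instance] fact_finrank_euclideanSpace_two fact_finrank_euclideanSpace_four

/-! ### The coordinate map of the band -/

section Coords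

variable {φ₁ φ₂ β β₂ : ℝ → ℝ} {w₁ w₂ v : ℝ → 𝔼 2}

/-- Partial derivatives of a differentiable map of `ℝ × ℝ` are derivatives of its slices.
[folklore] -/
theorem fderiv_apply_one_zero {F' : Type*} [NormedAddCommGroup F'] [NormedSpace ℝ F']
    {g : ℝ × ℝ → F'} {p : ℝ × ℝ} (hg : DifferentiableAt ℝ g p) :
    fderiv ℝ g p ((1 : ℝ), (0 : ℝ)) = deriv (fun t : ℝ ↦ g (t, p.2)) p.1 := by
  have h1 : HasDerivAt (fun t : ℝ ↦ ((t, p.2) : ℝ × ℝ)) ((1 : ℝ), (0 : ℝ)) p.1 :=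
    (hasDerivAt_id p.1).prodMk (hasDerivAt_const p.1 p.2)
  have h2 := hg.hasFDerivAt.comp_hasDerivAt p.1 h1
  exact h2.deriv.symm

/-- Partial derivatives of a differentiable map of `ℝ × ℝ` are derivatives of its slices.
[folklore] -/
theorem fderiv_apply_zero_one {F' : Type*} [NormedAddCommGroup F'] [NormedSpace ℝ F']
    {g : ℝ × ℝ → F'} {p : ℝ × ℝ} (hg : DifferentiableAt ℝ g p) :
    fderiv ℝ g p ((0 : ℝ), (1 : ℝ)) = deriv (fun t : ℝ ↦ g (p.1, t)) p.2 := by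
  have h1 : HasDerivAt (fun t : ℝ ↦ ((p.1, t) : ℝ × ℝ)) ((0 : ℝ), (1 : ℝ)) p.2 :=
    (hasDerivAt_const p.2 p.1).prodMk (hasDerivAt_id p.2)
  have h2 := hg.hasFDerivAt.comp_hasDerivAt p.2 h1
  exact h2.deriv.symm

/-- **The coordinate map of the band is an injective immersion on a uniform strip about the
core.**  For `C^∞` data `φ₁, φ₂, β, β₂ : ℝ → ℝ`, `w₁, w₂, v : ℝ → ℝ²` with `φᵢ 0 = 0`, `wᵢ 0 = 0`
and the non-degeneracy `β x • w₁' 0 + β₂ x • w₂' 0 + (1 - β x - β₂ x) • v x ≠ 0` for all `x`,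
the map `g (x, y) = (π x + β x φ₁ y + β₂ x φ₂ y, β x • w₁ y + β₂ x • w₂ y + ((1 - β x - β₂ x) y)
• v x)` of `ℝ × ℝ` into `ℝ × ℝ²` — which is `(π x, 0)` on the core `y = 0` — is injective on
`[-1, 2] × B(0, ε₀)` and has injective differential at `(x, y)`, `x ∈ [-1, 2]`, `|y| < ε₀`, for
some `ε₀ > 0`. [folklore] -/
theorem exists_strip_injOn_coords (hφ₁ : ContDiff ℝ ∞ φ₁) (hφ₂ : ContDiff ℝ ∞ φ₂)
    (hβ : ContDiff ℝ ∞ β) (hβ₂ : ContDiff ℝ ∞ β₂) (hw₁ : ContDiff ℝ ∞ w₁) (hw₂ : ContDiff ℝ ∞ w₂)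
    (hv : ContDiff ℝ ∞ v) (hφ₁0 : φ₁ 0 = 0) (hφ₂0 : φ₂ 0 = 0) (hw₁0 : w₁ 0 = 0) (hw₂0 : w₂ 0 = 0)
    (hnd : ∀ x, β x • deriv w₁ 0 + β₂ x • deriv w₂ 0 + (1 - β x - β₂ x) • v x ≠ 0)
    {g : ℝ × ℝ → ℝ × 𝔼 2}
    (hgdef : ∀ p, g p = (π * p.1 + β p.1 * φ₁ p.2 + β₂ p.1 * φ₂ p.2,
      β p.1 • w₁ p.2 + β₂ p.1 • w₂ p.2 + ((1 - β p.1 - β₂ p.1) * p.2) • v p.1)) :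
    ContDiff ℝ ∞ g ∧ ∃ ε₀ > 0, InjOn g (Icc (-1 : ℝ) 2 ×ˢ ball (0 : ℝ) ε₀) ∧
      ∀ x ∈ Icc (-1 : ℝ) 2, ∀ y : ℝ, |y| < ε₀ → Injective (fderiv ℝ g (x, y)) := by
  obtain rfl : g = fun p ↦ (π * p.1 + β p.1 * φ₁ p.2 + β₂ p.1 * φ₂ p.2,
      β p.1 • w₁ p.2 + β₂ p.1 • w₂ p.2 + ((1 - β p.1 - β₂ p.1) * p.2) • v p.1) := funext hgdef
  set g : ℝ × ℝ → ℝ × 𝔼 2 := fun p ↦ (π * p.1 + β p.1 * φ₁ p.2 + β₂ p.1 * φ₂ p.2,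
    β p.1 • w₁ p.2 + β₂ p.1 • w₂ p.2 + ((1 - β p.1 - β₂ p.1) * p.2) • v p.1) with hgdef'
  -- ### smoothness
  have hfst : ContDiff ℝ ∞ (Prod.fst : ℝ × ℝ → ℝ) := contDiff_fst
  have hsnd : ContDiff ℝ ∞ (Prod.snd : ℝ × ℝ → ℝ) := contDiff_snd
  have hgΦ : ContDiff ℝ ∞ fun p : ℝ × ℝ ↦ π * p.1 + β p.1 * φ₁ p.2 + β₂ p.1 * φ₂ p.2 :=
    ((contDiff_const.mul hfst).add ((hβ.comp hfst).mul (hφ₁.comp hsnd))).add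
      ((hβ₂.comp hfst).mul (hφ₂.comp hsnd))
  have hgW : ContDiff ℝ ∞ fun p : ℝ × ℝ ↦
      β p.1 • w₁ p.2 + β₂ p.1 • w₂ p.2 + ((1 - β p.1 - β₂ p.1) * p.2) • v p.1 :=
    (((hβ.comp hfst).smul (hw₁.comp hsnd)).add ((hβ₂.comp hfst).smul (hw₂.comp hsnd))).add
      ((((contDiff_const.sub (hβ.comp hfst)).sub (hβ₂.comp hfst)).mul hsnd).smul (hv.comp hfst))
  have hg : ContDiff ℝ ∞ g := hgΦ.prodMk hgW
  have hg1 : ContDiff ℝ 1 g := hg.of_le (by simp)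
  have hgd : Differentiable ℝ g := hg.differentiable (by simp)
  -- ### the core
  have hcore : ∀ x, g (x, 0) = (π * x, 0) := fun x ↦ by
    simp [hgdef', hφ₁0, hφ₂0, hw₁0, hw₂0]
  -- ### the differential along the core
  have hdx : ∀ x, fderiv ℝ g (x, 0) ((1 : ℝ), (0 : ℝ)) = ((π : ℝ), (0 : 𝔼 2)) := fun x ↦ by
    rw [fderiv_apply_one_zero (hgd _)]
    have : (fun t : ℝ ↦ g (t, ((x, (0 : ℝ)) : ℝ × ℝ).2)) = fun t : ℝ ↦ ((π * t, 0) : ℝ × 𝔼 2) := by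
      funext t
      exact hcore t
    rw [this]
    have h1 : HasDerivAt (fun t : ℝ ↦ ((π * t, 0) : ℝ × 𝔼 2)) ((π : ℝ), (0 : 𝔼 2)) x := by
      have h2 : HasDerivAt (fun t : ℝ ↦ π * t) π x := by
        simpa using (hasDerivAt_id x).const_mul π
      exact h2.prodMk (hasDerivAt_const x (0 : 𝔼 2))
    exact h1.deriv
  have hdy : ∀ x, (fderiv ℝ g (x, 0) ((0 : ℝ), (1 : ℝ))).2 =
      β x • deriv w₁ 0 + β₂ x • deriv w₂ 0 + (1 - β x - β₂ x) • v x := fun x ↦ by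
    rw [fderiv_apply_zero_one (hgd _)]
    -- the slice `y ↦ g (x, y)` and its second component
    have hsl : HasDerivAt (fun t : ℝ ↦ (g (x, t)).2)
        (β x • deriv w₁ 0 + β₂ x • deriv w₂ 0 + (1 - β x - β₂ x) • v x) 0 := by
      have h1 : HasDerivAt (fun t : ℝ ↦ β x • w₁ t) (β x • deriv w₁ 0) 0 :=
        ((hw₁.differentiable (by simp)) 0).hasDerivAt.const_smul (β x)
      have h2 : HasDerivAt (fun t : ℝ ↦ β₂ x • w₂ t) (β₂ x • deriv w₂ 0) 0 :=
        ((hw₂.differentiable (by simp)) 0).hasDerivAt.const_smul (β₂ x)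
      have h3 : HasDerivAt (fun t : ℝ ↦ ((1 - β x - β₂ x) * t) • v x) ((1 - β x - β₂ x) • v x) 0 := by
        have h4 : HasDerivAt (fun t : ℝ ↦ (1 - β x - β₂ x) * t) (1 - β x - β₂ x) 0 := by
          simpa using (hasDerivAt_id (0 : ℝ)).const_mul (1 - β x - β₂ x)
        simpa using h4.smul_const (v x)
      have h := (h1.add h2).add h3
      refine h.congr_of_eventuallyEq (Filter.Eventually.of_forall fun t ↦ ?_)
      simp [hgdef']
    have hslice : HasDerivAt (fun t : ℝ ↦ g (((x, (0 : ℝ)) : ℝ × ℝ).1, t)) (deriv (fun t : ℝ ↦ g (x, t)) 0) 0 :=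
      ((hgd _).comp 0 ((hasDerivAt_const (0 : ℝ) x).prodMk (hasDerivAt_id 0)).differentiableAt).hasDerivAt
    have h2 : HasDerivAt (fun t : ℝ ↦ (g (x, t)).2) (deriv (fun t : ℝ ↦ g (x, t)) 0).2 0 :=
      hslice.snd
    exact h2.unique hsl ▸ rfl
  have hinj0 : ∀ x, Injective (fderiv ℝ g (x, 0)) := fun x ↦ by
    apply injective_of_linearIndependent_pair (A := (fderiv ℝ g (x, 0) : ℝ × ℝ →ₗ[ℝ] ℝ × 𝔼 2))
    rw [LinearIndependent.pair_iff]
    intro s t hst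
    change s • fderiv ℝ g (x, 0) ((1 : ℝ), (0 : ℝ)) + t • fderiv ℝ g (x, 0) ((0 : ℝ), (1 : ℝ)) = 0 at hst
    rw [hdx x] at hst
    have h2 := congrArg Prod.snd hst
    simp only [Prod.snd_add, Prod.smul_snd, smul_zero, zero_add, Prod.snd_zero, hdy x] at h2
    have ht : t = 0 := by
      by_contra ht
      exact hnd x ((smul_eq_zero.1 h2).resolve_left ht)
    subst ht
    have h1 := congrArg Prod.fst hst
    simp only [Prod.smul_fst, smul_eq_mul, zero_smul, add_zero, Prod.fst_zero] at h1
    exact ⟨(mul_eq_zero.1 h1).resolve_right Real.pi_pos.ne', rfl⟩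
  -- ### injectivity on a strip
  have hloc : ∀ x ∈ Icc (-1 : ℝ) 2, ∃ N ∈ 𝓝 ((x, (0 : ℝ)) : ℝ × ℝ), InjOn g N := fun x _ ↦
    exists_mem_nhds_injOn_of_hasStrictFDerivAt (hg.contDiffAt.hasStrictFDerivAt (by simp)) (hinj0 x)
  have hcore_inj : InjOn (fun x : ℝ ↦ g (x, 0)) (Icc (-1 : ℝ) 2) := by
    intro x _ x' _ h
    have h1 : π * x = π * x' := by
      have := congrArg Prod.fst h
      simpa [hcore] using this
    exact mul_left_cancel₀ Real.pi_pos.ne' h1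
  obtain ⟨ε₁, hε₁, hinj₁⟩ := exists_injOn_prod_ball_of_isCompact hg.continuous isCompact_Icc hcore_inj hloc
  obtain ⟨ε₂, hε₂, hinj₂⟩ := exists_forall_injective_fderiv_near hg1 isCompact_Icc fun x _ ↦ hinj0 x
  refine ⟨hg, min ε₁ ε₂, lt_min hε₁ hε₂, ?_, fun x hx y hy ↦ hinj₂ x hx y (hy.trans_le (min_le_right _ _))⟩
  exact hinj₁.mono (prod_mono Subset.rfl (ball_subset_ball (min_le_left _ _)))

end Coords

/-! ### The cut-off -/

section Cutoff

/-- The cut-off `β x = smoothTransition (2 - 8x)`: `1` for `x ≤ 1/8`. [folklore] -/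
theorem cutoff_eq_one {x : ℝ} (hx : x ≤ 1 / 8) : Real.smoothTransition (2 - 8 * x) = 1 :=
  Real.smoothTransition.one_of_one_le (by linarith)

/-- The cut-off `β x = smoothTransition (2 - 8x)`: `0` for `x ≥ 1/4`. [folklore] -/
theorem cutoff_eq_zero {x : ℝ} (hx : 1 / 4 ≤ x) : Real.smoothTransition (2 - 8 * x) = 0 :=
  Real.smoothTransition.zero_of_nonpos (by linarith)

/-- The cut-off is smooth. [folklore] -/
theorem contDiff_cutoff : ContDiff ℝ ∞ fun x : ℝ ↦ Real.smoothTransition (2 - 8 * x) :=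
  Real.smoothTransition.contDiff.comp (contDiff_const.sub (contDiff_const.mul contDiff_id))

end Cutoff

/-! ### Derivatives along the edge lines -/

/-- The partial derivative `∂/∂x₁` of a differentiable map on the plane at `(a, s)` is the
derivative of its restriction to the vertical line `t ↦ (a, t)`. [folklore] -/
theorem fderiv_pt2_zero_one {F' : Type*} [NormedAddCommGroup F'] [NormedSpace ℝ F']
    {F : 𝔼 2 → F'} {a s : ℝ} (hF : DifferentiableAt ℝ F (pt2 a s)) :
    fderiv ℝ F (pt2 a s) (pt2 0 1) = deriv (fun t : ℝ ↦ F (pt2 a t)) s :=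
  (hF.hasFDerivAt.comp_hasDerivAt s (hasDerivAt_pt2_right a s)).deriv.symm

/-- `(0, -1) = -(0, 1)` in the plane. [folklore] -/
theorem pt2_zero_neg_one : pt2 0 (-1) = -pt2 0 1 := by
  ext i
  fin_cases i <;> simp [pt2]

/-! ### The band in the tube of the core loop -/

namespace Knot

set_option maxHeartbeats 4000000 in
/-- **A band core between two knots crossed transversally by an auxiliary embedded circle.**
Let `K₁ K₂ E : Knot` with `E (circlePoint 0) = K₁ (circlePoint θ₁)`,
`E (circlePoint π) = K₂ (circlePoint θ₂)`, `E` meeting `K₁`, `K₂` in no other points and crossing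
them transversally there (the velocity of `Kᵢ` is not a multiple of that of `E`), and
`range E ⊆ U`, `U` open.  Then there is a band core from `K₁` to `K₂` avoiding `Uᶜ`
(`Literature.Topology.FourManifolds.BandCore`), namely the explicit band in the tubular coordinates
of `E` described in the module docstring.  Gompf–Stipsicz (1999), §5.1, Fig. 5.7; Kirby (1989),
Ch. I §4, p. 10. [cite: GompfStipsicz1999, §5.1] -/
theorem nonempty_bandCore_of_loop (K₁ K₂ E : Knot) {U : Set (𝕊 3)} (hU : IsOpen U)
    (hEU : range E ⊆ U) {θ₁ θ₂ : ℝ} (hp : E (circlePoint 0) = K₁ (circlePoint θ₁))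
    (hq : E (circlePoint π) = K₂ (circlePoint θ₂))
    (hK₁ : range E ∩ range K₁ ⊆ {K₁ (circlePoint θ₁)})
    (hK₂ : range E ∩ range K₂ ⊆ {K₂ (circlePoint θ₂)})
    (ht₁ : ∀ c : ℝ, K₁.tangent θ₁ ≠ c • E.tangent 0)
    (ht₂ : ∀ c : ℝ, K₂.tangent θ₂ ≠ c • E.tangent π) :
    Nonempty (BandCore K₁ K₂ Uᶜ) := by
  have hn : (∞ : WithTop ℕ∞) ≠ 0 := by simp
  have hπ := Real.pi_pos
  have hπ3 : (3 : ℝ) < π := Real.pi_gt_three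
  -- ### local angles at `circlePoint 0` and `circlePoint π`
  have hcp0 : (circlePoint 0 : 𝕊 1) = ptA := by
    simp [ptA, circlePt_eq_circlePoint]
  have hcpπ : (circlePoint π : 𝕊 1) = ptB := by
    rw [ptB, circlePt_eq_circlePoint]
    congr 1
    ring
  set angL : 𝕊 1 → ℝ := fun u ↦ 2 * π * angB u - 2 * π with hangL
  have hangL₁ : ∀ u, circlePoint (angL u) = u := fun u ↦ by
    change circlePoint (2 * π * angB u - 2 * π) = u
    rw [periodic_circlePoint.sub_eq, circlePoint_two_pi_mul_angB]
  have hangL₂ : ∀ u ∈ ({ptB}ᶜ : Set (𝕊 1)), ContMDiffAt (𝓡 1) 𝓘(ℝ, ℝ) ∞ angL u := fun u hu ↦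
    (contMDiffAt_const.mul (contMDiffAt_angB hu)).sub contMDiffAt_const
  have hangL₃ : angL (circlePoint 0) = 0 := by
    have h1 : angB (circlePoint 0 : 𝕊 1) = 1 := by
      have : (circlePoint 0 : 𝕊 1) = circlePt 1 := by
        rw [circlePt_eq_circlePoint, mul_one, ← zero_add (2 * π), circlePoint_add_two_pi]
      rw [this]
      exact angB_circlePt ⟨by norm_num, by norm_num⟩
    simp [hangL, h1]
  have h0A : (circlePoint 0 : 𝕊 1) ∈ ({ptB}ᶜ : Set (𝕊 1)) := by
    rw [mem_compl_singleton_iff, hcp0]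
    exact ptA_ne_ptB
  set angR : 𝕊 1 → ℝ := fun u ↦ 2 * π * angA u with hangR
  have hangR₁ : ∀ u, circlePoint (angR u) = u := fun u ↦ circlePoint_two_pi_mul_angA u
  have hangR₂ : ∀ u ∈ ({ptA}ᶜ : Set (𝕊 1)), ContMDiffAt (𝓡 1) 𝓘(ℝ, ℝ) ∞ angR u := fun u hu ↦
    contMDiffAt_const.mul (contMDiffAt_angA hu)
  have hangR₃ : angR (circlePoint π) = π := by
    have h1 : angA (circlePoint π : 𝕊 1) = 1 / 2 := by
      rw [hcpπ, ptB]
      exact angA_circlePt ⟨by norm_num, by norm_num⟩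
    simp only [hangR, h1]
    ring
  have hπA : (circlePoint π : 𝕊 1) ∈ ({ptA}ᶜ : Set (𝕊 1)) := by
    rw [mem_compl_singleton_iff, hcpπ]
    exact ptA_ne_ptB.symm
  -- ### the two crossing germs
  have hb : (0 : ℝ) < π / 64 := by positivity
  obtain ⟨ε₁, hε₁, φ₁, w₁, hφ₁s, hw₁s, hφ₁0, hw₁0, hd₁, hw₁inj, hφ₁b, -, hG₁⟩ :=
    E.exists_edgeGerm K₁ (s := 1) (Or.inl rfl) hp ht₁ angL isOpen_compl_singleton h0A
      hangL₁ hangL₂ hangL₃ hb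
  obtain ⟨ε₂, hε₂, φ₂, w₂, hφ₂s, hw₂s, hφ₂0, hw₂0, hd₂, hw₂inj, hφ₂b, -, hG₂⟩ :=
    E.exists_edgeGerm K₂ (s := -1) (Or.inr rfl) hq ht₂ angR isOpen_compl_singleton hπA
      hangR₁ hangR₂ hangR₃ hb
  simp only [zero_add, one_mul] at hG₁
  -- ### the rotating field and the cut-offs
  obtain ⟨v, hvs, hv₁, hv₂, hvne⟩ := exists_rotating_field hd₁ hd₂
  obtain ⟨β, hβs, hβ1, hβ0, hβ01⟩ : ∃ β : ℝ → ℝ, ContDiff ℝ ∞ β ∧ (∀ x, x ≤ 1 / 8 → β x = 1) ∧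
      (∀ x, 1 / 4 ≤ x → β x = 0) ∧ ∀ x, 0 ≤ β x ∧ β x ≤ 1 :=
    ⟨fun x ↦ Real.smoothTransition (2 - 8 * x), contDiff_cutoff, fun x hx ↦ cutoff_eq_one hx,
      fun x hx ↦ cutoff_eq_zero hx,
      fun x ↦ ⟨Real.smoothTransition.nonneg _, Real.smoothTransition.le_one _⟩⟩
  obtain ⟨β₂, hβ₂s, hβ₂1, hβ₂0, hβ₂01⟩ : ∃ β₂ : ℝ → ℝ, ContDiff ℝ ∞ β₂ ∧ (∀ x, 7 / 8 ≤ x → β₂ x = 1) ∧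
      (∀ x, x ≤ 3 / 4 → β₂ x = 0) ∧ ∀ x, 0 ≤ β₂ x ∧ β₂ x ≤ 1 :=
    ⟨fun x ↦ β (1 - x), hβs.comp (contDiff_const.sub contDiff_id), fun x hx ↦ hβ1 _ (by linarith),
      fun x hx ↦ hβ0 _ (by linarith), fun x ↦ hβ01 _⟩
  have hμ01 : ∀ x, 0 ≤ 1 - β x - β₂ x ∧ 1 - β x - β₂ x ≤ 1 := fun x ↦ by
    rcases le_or_gt x (1 / 2) with hx | hx
    · rw [hβ₂0 x (by linarith)]
      constructor <;> linarith [(hβ01 x).1, (hβ01 x).2]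
    · rw [hβ0 x (by linarith)]
      constructor <;> linarith [(hβ₂01 x).1, (hβ₂01 x).2]
  have hnd : ∀ x, β x • deriv w₁ 0 + β₂ x • deriv w₂ 0 + (1 - β x - β₂ x) • v x ≠ 0 := by
    intro x
    rcases le_or_gt x (1 / 4) with hx | hx
    · rw [hβ₂0 x (by linarith), hv₁ x hx, zero_smul, add_zero, sub_zero, ← add_smul,
        add_sub_cancel, one_smul]
      exact hd₁
    rcases le_or_gt (3 / 4) x with hx' | hx'
    · rw [hβ0 x hx.le, hv₂ x hx', zero_smul, zero_add, sub_zero, ← add_smul, add_sub_cancel,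
        one_smul]
      exact hd₂
    · rw [hβ0 x hx.le, hβ₂0 x hx'.le]
      simpa using hvne x
  -- ### the coordinate map of the band
  obtain ⟨g, hg⟩ : ∃ g : ℝ × ℝ → ℝ × 𝔼 2, ∀ p, g p = (π * p.1 + β p.1 * φ₁ p.2 + β₂ p.1 * φ₂ p.2,
      β p.1 • w₁ p.2 + β₂ p.1 • w₂ p.2 + ((1 - β p.1 - β₂ p.1) * p.2) • v p.1) := ⟨_, fun _ ↦ rfl⟩
  obtain ⟨hgs, ε₀, hε₀, hginj, hgder⟩ := exists_strip_injOn_coords hφ₁s hφ₂s hβs hβ₂s hw₁s hw₂s hvs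
    hφ₁0 hφ₂0 hw₁0 hw₂0 hnd hg
  -- ### radii: separation of the knots, the open set `U`
  set τ : ℝ := min (min ε₁ ε₂) 1 with hτdef
  have hτ : 0 < τ := lt_min (lt_min hε₁ hε₂) one_pos
  have hτε₁ : τ ≤ ε₁ := (min_le_left _ _).trans (min_le_left _ _)
  have hτε₂ : τ ≤ ε₂ := (min_le_left _ _).trans (min_le_right _ _)
  have hτπ : τ ≤ π := (min_le_right _ _).trans (by linarith)
  obtain ⟨ρ₁, hρ₁, hsep₁⟩ := E.exists_radius_tube_inter_range K₁ hK₁ hτ hτπ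
  obtain ⟨ρ₂, hρ₂, hsep₂⟩ := E.exists_radius_tube_inter_range K₂ hK₂ hτ hτπ
  obtain ⟨ρU, hρU, hmemU⟩ := E.exists_forall_tubularMap_mem hU hEU
  set ρ : ℝ := min ρU (min ρ₁ ρ₂) with hρdef
  have hρ : 0 < ρ := lt_min hρU (lt_min hρ₁ hρ₂)
  have hρρU : ρ ≤ ρU := min_le_left _ _
  have hρρ₁ : ρ ≤ ρ₁ := (min_le_right _ _).trans (min_le_left _ _)
  have hρρ₂ : ρ ≤ ρ₂ := (min_le_right _ _).trans (min_le_right _ _)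
  -- a bound for the field on `[-1, 2]`, continuity of `w₁`, `w₂` at `0`
  obtain ⟨M₀, hM₀⟩ := (isCompact_Icc (a := (-1 : ℝ)) (b := 2)).exists_bound_of_continuousOn
    (f := v) hvs.continuous.continuousOn
  set M : ℝ := max M₀ 0 + 1 with hMdef
  have hM : 0 < M := by have := le_max_right M₀ 0; linarith
  have hvM : ∀ x ∈ Icc (-1 : ℝ) 2, ‖v x‖ ≤ M := fun x hx ↦
    (hM₀ x hx).trans ((le_max_left _ _).trans (by linarith))
  obtain ⟨η, hη, hηw⟩ : ∃ η > 0, ∀ y : ℝ, |y| < η → ‖w₁ y‖ < ρ / 4 ∧ ‖w₂ y‖ < ρ / 4 := by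
    have h1 : ∀ᶠ y in 𝓝 (0 : ℝ), ‖w₁ y‖ < ρ / 4 := by
      have := hw₁s.continuous.continuousAt.preimage_mem_nhds
        (Metric.ball_mem_nhds (w₁ 0) (by positivity : (0 : ℝ) < ρ / 4))
      filter_upwards [this] with y hy
      simpa [dist_eq_norm, hw₁0] using hy
    have h2 : ∀ᶠ y in 𝓝 (0 : ℝ), ‖w₂ y‖ < ρ / 4 := by
      have := hw₂s.continuous.continuousAt.preimage_mem_nhds
        (Metric.ball_mem_nhds (w₂ 0) (by positivity : (0 : ℝ) < ρ / 4))
      filter_upwards [this] with y hy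
      simpa [dist_eq_norm, hw₂0] using hy
    obtain ⟨η, hη, hball⟩ := Metric.eventually_nhds_iff_ball.1 (h1.and h2)
    exact ⟨η, hη, fun y hy ↦ hball y (by simpa [Real.dist_eq] using hy)⟩
  -- ### the width `κ`
  obtain ⟨κ, hκ, hκτ, hκε₀, hκη, hκρ⟩ : ∃ κ : ℝ, 0 < κ ∧ κ < τ ∧ κ < ε₀ ∧ κ < η ∧ κ * M < ρ / 4 := by
    set m : ℝ := min (min τ ε₀) (min η (ρ / (8 * M))) with hmdef
    have hm : 0 < m := lt_min (lt_min hτ hε₀) (lt_min hη (by positivity))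
    have hκm : m / 2 < m := by linarith
    refine ⟨m / 2, by positivity, hκm.trans_le ((min_le_left _ _).trans (min_le_left _ _)),
      hκm.trans_le ((min_le_left _ _).trans (min_le_right _ _)),
      hκm.trans_le ((min_le_right _ _).trans (min_le_left _ _)), ?_⟩
    have h1 : m / 2 < ρ / (8 * M) := hκm.trans_le ((min_le_right _ _).trans (min_le_right _ _))
    have h2 : m / 2 * M < ρ / (8 * M) * M := mul_lt_mul_of_pos_right h1 hM
    have h3 : ρ / (8 * M) * M = ρ / 8 := by field_simp
    linarith
  have hκε₁ : κ < ε₁ := hκτ.trans_le hτε₁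
  have hκε₂ : κ < ε₂ := hκτ.trans_le hτε₂
  -- ### the band
  obtain ⟨yt, hytd⟩ : ∃ yt : 𝔼 2 → ℝ, ∀ x, yt x = κ * (x 1 - 1 / 2) := ⟨_, fun _ ↦ rfl⟩
  obtain ⟨Af, hAfd⟩ : ∃ Af : 𝔼 2 → ℝ × ℝ, ∀ x, Af x = (x 0, yt x) := ⟨_, fun _ ↦ rfl⟩
  obtain ⟨band, hbandd⟩ : ∃ band : 𝔼 2 → 𝕊 3,
      ∀ x, band x = E.tubularMap (circlePoint (g (Af x)).1, (g (Af x)).2) := ⟨_, fun _ ↦ rfl⟩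
  -- the coordinates of the band
  have hΦd : ∀ x, (g (Af x)).1 = π * x 0 + β (x 0) * φ₁ (yt x) + β₂ (x 0) * φ₂ (yt x) := fun x ↦ by
    rw [hAfd, hg]
  have hWd : ∀ x, (g (Af x)).2 =
      β (x 0) • w₁ (yt x) + β₂ (x 0) • w₂ (yt x) + ((1 - β (x 0) - β₂ (x 0)) * yt x) • v (x 0) := fun x ↦ by
    rw [hAfd, hg]
  -- smoothness of the pieces
  have hc0 : ContDiff ℝ ∞ fun x : 𝔼 2 ↦ x 0 := contDiff_euclidean_apply 0
  have hc1 : ContDiff ℝ ∞ fun x : 𝔼 2 ↦ x 1 := contDiff_euclidean_apply 1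
  have hyts : ContDiff ℝ ∞ yt := by
    rw [show yt = fun x ↦ κ * (x 1 - 1 / 2) from funext hytd]
    exact contDiff_const.mul (hc1.sub contDiff_const)
  have hAfs : ContDiff ℝ ∞ Af := by
    rw [show Af = fun x ↦ (x 0, yt x) from funext hAfd]
    exact hc0.prodMk hyts
  have hPs : ContDiff ℝ ∞ (g ∘ Af) := hgs.comp hAfs
  have hbandf : band = fun x ↦ E.tubularMap (circlePoint (g (Af x)).1, (g (Af x)).2) := funext hbandd
  have hbands : ContMDiff 𝓘(ℝ, 𝔼 2) (𝓡 3) ∞ band := by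
    have hin : ContMDiff 𝓘(ℝ, 𝔼 2) 𝓘₁₂ ∞
        fun x : 𝔼 2 ↦ ((circlePoint (g (Af x)).1, (g (Af x)).2) : (𝕊 1) × 𝔼 2) :=
      (contMDiff_circlePoint.comp (contDiff_fst.comp hPs).contMDiff).prodMk
        (contDiff_snd.comp hPs).contMDiff
    rw [hbandf]
    exact E.contMDiff_tubularMap.comp hin
  have hcoe : ∀ x, ((band x : 𝕊 3) : 𝔼 4) = E.tubeδ E.tubularRadius (g (Af x)) := fun x ↦ by
    rw [hbandd, E.coe_tubularMap_circlePoint]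
  have hcoe' : (fun x ↦ ((band x : 𝕊 3) : 𝔼 4)) = E.tubeδ E.tubularRadius ∘ g ∘ Af :=
    funext fun x ↦ hcoe x
  -- ### elementary estimates on the collar square of width `1/4`
  have hsq : ∀ x ∈ squareNhd (1 / 4 : ℝ), x 0 ∈ Ioo (-(1 / 4) : ℝ) (5 / 4) ∧ x 1 ∈ Ioo (-(1 / 4) : ℝ) (5 / 4) := by
    intro x hx
    rw [mem_squareNhd_iff] at hx
    have h0 := hx 0
    have h1 := hx 1
    norm_num at h0 h1
    exact ⟨h0, h1⟩
  have hx0I : ∀ x ∈ squareNhd (1 / 4 : ℝ), x 0 ∈ Icc (-1 : ℝ) 2 := fun x hx ↦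
    ⟨by linarith [(hsq x hx).1.1], by linarith [(hsq x hx).1.2]⟩
  have hyt : ∀ x ∈ squareNhd (1 / 4 : ℝ), |yt x| < κ := fun x hx ↦ by
    obtain ⟨-, h1, h2⟩ := hsq x hx
    rw [hytd, abs_mul, abs_of_pos hκ]
    have : |x 1 - 1 / 2| < 3 / 4 := abs_lt.2 ⟨by linarith, by linarith⟩
    nlinarith
  have hΦest : ∀ x, |(g (Af x)).1 - π * x 0| ≤ π / 32 := fun x ↦ by
    rw [hΦd, show π * x 0 + β (x 0) * φ₁ (yt x) + β₂ (x 0) * φ₂ (yt x) - π * x 0 =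
      β (x 0) * φ₁ (yt x) + β₂ (x 0) * φ₂ (yt x) by ring]
    have h1 : |β (x 0) * φ₁ (yt x)| ≤ π / 64 := by
      rw [abs_mul, abs_of_nonneg (hβ01 _).1]
      exact (mul_le_mul (hβ01 _).2 (hφ₁b _) (abs_nonneg _) zero_le_one).trans (by rw [one_mul])
    have h2 : |β₂ (x 0) * φ₂ (yt x)| ≤ π / 64 := by
      rw [abs_mul, abs_of_nonneg (hβ₂01 _).1]
      exact (mul_le_mul (hβ₂01 _).2 (hφ₂b _) (abs_nonneg _) zero_le_one).trans (by rw [one_mul])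
    exact (abs_add_le _ _).trans (by linarith)
  have hWest : ∀ x ∈ squareNhd (1 / 4 : ℝ), ‖(g (Af x)).2‖ < ρ := fun x hx ↦ by
    have hy := hyt x hx
    obtain ⟨hw1, hw2⟩ := hηw (yt x) (hy.trans hκη)
    rw [hWd]
    have h1 : ‖β (x 0) • w₁ (yt x)‖ ≤ ρ / 4 := by
      rw [norm_smul, Real.norm_of_nonneg (hβ01 _).1]
      exact (mul_le_mul (hβ01 _).2 hw1.le (norm_nonneg _) zero_le_one).trans (by rw [one_mul])
    have h2 : ‖β₂ (x 0) • w₂ (yt x)‖ ≤ ρ / 4 := by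
      rw [norm_smul, Real.norm_of_nonneg (hβ₂01 _).1]
      exact (mul_le_mul (hβ₂01 _).2 hw2.le (norm_nonneg _) zero_le_one).trans (by rw [one_mul])
    have h3 : ‖((1 - β (x 0) - β₂ (x 0)) * yt x) • v (x 0)‖ ≤ ρ / 4 := by
      rw [norm_smul, norm_mul, Real.norm_of_nonneg (hμ01 _).1, Real.norm_eq_abs]
      have hv' := hvM (x 0) (hx0I x hx)
      calc (1 - β (x 0) - β₂ (x 0)) * |yt x| * ‖v (x 0)‖ ≤ 1 * κ * M := by
            apply mul_le_mul (mul_le_mul (hμ01 _).2 hy.le (abs_nonneg _) zero_le_one) hv'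
              (norm_nonneg _) (by positivity)
        _ ≤ ρ / 4 := by rw [one_mul]; exact hκρ.le
    calc ‖β (x 0) • w₁ (yt x) + β₂ (x 0) • w₂ (yt x) + ((1 - β (x 0) - β₂ (x 0)) * yt x) • v (x 0)‖
        ≤ ‖β (x 0) • w₁ (yt x)‖ + ‖β₂ (x 0) • w₂ (yt x)‖ + ‖((1 - β (x 0) - β₂ (x 0)) * yt x) • v (x 0)‖ :=
          norm_add₃_le
      _ ≤ ρ / 4 + ρ / 4 + ρ / 4 := by linarith
      _ < ρ := by linarith
  -- angles of points of the square are within `2π` of each other and near `[0, π]`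
  have hΦrange : ∀ x ∈ squareNhd (1 / 4 : ℝ), -(π / 4) - π / 32 < (g (Af x)).1 ∧ (g (Af x)).1 < 5 * π / 4 + π / 32 := by
    intro x hx
    obtain ⟨⟨h1, h2⟩, -⟩ := hsq x hx
    have h := abs_le.1 (hΦest x)
    constructor <;> nlinarith [h.1, h.2]
  -- ### the edge lines
  have hedgeL : ∀ s : ℝ, band (pt2 0 s) =
      E.tubularMap (circlePoint (φ₁ (κ * (s - 1 / 2))), w₁ (κ * (s - 1 / 2))) := by
    intro s
    have h0 : (pt2 0 s : 𝔼 2) 0 = 0 := pt2_apply_zero 0 s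
    have h1 : (pt2 0 s : 𝔼 2) 1 = s := pt2_apply_one 0 s
    have hb1 : β 0 = 1 := hβ1 0 (by norm_num)
    have hb2 : β₂ 0 = 0 := hβ₂0 0 (by norm_num)
    have hy : yt (pt2 0 s) = κ * (s - 1 / 2) := by rw [hytd, h1]
    rw [hbandd, hΦd, hWd, hy, h0, hb1, hb2]
    congr 2
    · simp
    · simp
  have hedgeR : ∀ s : ℝ, band (pt2 1 s) =
      E.tubularMap (circlePoint (π + φ₂ (κ * (s - 1 / 2))), w₂ (κ * (s - 1 / 2))) := by
    intro s
    have h0 : (pt2 1 s : 𝔼 2) 0 = 1 := pt2_apply_zero 1 s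
    have h1 : (pt2 1 s : 𝔼 2) 1 = s := pt2_apply_one 1 s
    have hb1 : β 1 = 0 := hβ0 1 (by norm_num)
    have hb2 : β₂ 1 = 1 := hβ₂1 1 (by norm_num)
    have hy : yt (pt2 1 s) = κ * (s - 1 / 2) := by rw [hytd, h1]
    rw [hbandd, hΦd, hWd, hy, h0, hb1, hb2]
    congr 2
    · simp
    · simp
  have hedgeL' : ∀ s : ℝ, |κ * (s - 1 / 2)| ≤ ε₁ →
      band (pt2 0 s) = K₁ (circlePoint (θ₁ + κ * (s - 1 / 2))) := fun s hs ↦ by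
    rw [hedgeL s, hG₁ _ hs]
  have hedgeR' : ∀ s : ℝ, |κ * (s - 1 / 2)| ≤ ε₂ →
      band (pt2 1 s) = K₂ (circlePoint (θ₂ - κ * (s - 1 / 2))) := fun s hs ↦ by
    rw [hedgeR s, hG₂ _ hs]
    congr 2
    ring
  -- ### integer bookkeeping: `2πk` with `|2k - a| < 1/8` and `a ∈ (-5/4 - ·, 5/4 + ·)` forces `k = 0`
  have hk0 : ∀ (k : ℤ) (a : ℝ), -(5 / 4) < a → a < 5 / 4 → |(2 : ℝ) * k - a| < 1 / 8 → k = 0 := by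
    intro k a ha1 ha2 hk
    have h := abs_lt.1 hk
    have hk1 : (k : ℝ) < 1 := by linarith
    have hk2 : (-1 : ℝ) < k := by linarith
    have hk1' : k < 1 := by exact_mod_cast hk1
    have hk2' : -1 < k := by exact_mod_cast hk2
    omega
  -- ### the band core
  refine ⟨⟨band, 1 / 4, by norm_num, hbands, ?_, ?_, ?_, ?_, ?_, ?_, ?_⟩⟩
  · -- ### injectivity on the collar square
    intro x hx x' hx' heq
    rw [hbandd, hbandd] at heq
    have h1 := E.tubularMap_injective heq
    obtain ⟨hc, hw⟩ := Prod.mk.inj h1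
    obtain ⟨k, hk⟩ := exists_eq_add_of_circlePoint_eq hc
    -- the angles differ by less than `2π`, so `k = 0`
    have hk' : k = 0 := by
      obtain ⟨ha1, ha2⟩ := hΦrange x hx
      obtain ⟨hb1, hb2⟩ := hΦrange x' hx'
      have h : |(k : ℝ) * (2 * π)| < 2 * π := by
        rw [show (k : ℝ) * (2 * π) = (g (Af x)).1 - (g (Af x')).1 by rw [hk]; ring]
        rw [abs_lt]
        constructor <;> nlinarith
      rw [abs_mul, abs_of_pos (by positivity : (0 : ℝ) < 2 * π)] at h
      have h' : |(k : ℝ)| < 1 := by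
        by_contra hh
        rw [not_lt] at hh
        nlinarith
      have h1 : (k : ℝ) < 1 := (abs_lt.1 h').2
      have h2 : (-1 : ℝ) < k := (abs_lt.1 h').1
      have h1' : k < 1 := by exact_mod_cast h1
      have h2' : -1 < k := by exact_mod_cast h2
      omega
    rw [hk', Int.cast_zero, zero_mul, add_zero] at hk
    have hgeq : g (Af x) = g (Af x') := Prod.ext hk hw
    have hmem : ∀ z ∈ squareNhd (1 / 4 : ℝ), Af z ∈ Icc (-1 : ℝ) 2 ×ˢ ball (0 : ℝ) ε₀ := fun z hz ↦ by
      rw [hAfd]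
      exact ⟨hx0I z hz, by
        rw [mem_ball_zero_iff, Real.norm_eq_abs]
        exact (hyt z hz).trans hκε₀⟩
    have hA := hginj (hmem x hx) (hmem x' hx') hgeq
    rw [hAfd, hAfd] at hA
    obtain ⟨hA0, hA1⟩ := Prod.mk.inj hA
    have hA1' : x 1 = x' 1 := by
      rw [hytd, hytd] at hA1
      have := mul_left_cancel₀ hκ.ne' hA1
      linarith
    ext i
    fin_cases i
    · exact hA0
    · exact hA1'
  · -- ### immersion on the collar square
    intro x hx
    apply injective_mfderiv_of_injective_fderiv_coe hbands
    rw [hcoe']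
    have hgd : DifferentiableAt ℝ g (Af x) := hgs.differentiable (by simp) _
    have hAd : DifferentiableAt ℝ Af x := hAfs.differentiable (by simp) _
    have htd : DifferentiableAt ℝ (E.tubeδ E.tubularRadius) (g (Af x)) := (E.differentiable_tubeδ E.tubularRadius) _
    rw [fderiv_comp x htd (hgd.comp x hAd), fderiv_comp x hgd hAd]
    simp only [ContinuousLinearMap.coe_comp]
    have hgx : Injective (fderiv ℝ g (Af x)) := by
      rw [hAfd]
      exact hgder (x 0) (hx0I x hx) (yt x) ((hyt x hx).trans hκε₀)
    refine (E.fderiv_tubeδ_injective E.tubularRadius_pos E.tubularRadius_le_jacobiRadius _).comp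
      (hgx.comp ?_)
    -- the differential of the affine map `Af`
    set Lf : 𝔼 2 →L[ℝ] ℝ × ℝ :=
      (EuclideanSpace.proj (0 : Fin 2)).prod (κ • EuclideanSpace.proj (1 : Fin 2)) with hLf
    have hL0 : ∀ h : 𝔼 2, (Lf h).1 = h 0 := fun h ↦ rfl
    have hL1 : ∀ h : 𝔼 2, (Lf h).2 = κ * h 1 := fun h ↦ rfl
    have hAfL : Af = fun z ↦ Lf z + ((0 : ℝ), -(κ / 2)) := by
      funext z
      rw [hAfd, hytd]
      refine Prod.ext ?_ ?_
      · rw [Prod.fst_add, hL0, add_zero]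
      · rw [Prod.snd_add, hL1]
        ring
    have hAf : HasFDerivAt Af Lf x := by
      rw [hAfL]
      exact Lf.hasFDerivAt.add_const _
    rw [hAf.fderiv]
    intro h h' hh
    have hh' : (Lf h).1 = (Lf h').1 := by rw [hh]
    have hh'' : (Lf h).2 = (Lf h').2 := by rw [hh]
    rw [hL0, hL0] at hh'
    rw [hL1, hL1] at hh''
    ext i
    fin_cases i
    · exact hh'
    · exact mul_left_cancel₀ hκ.ne' hh''
  · -- ### the band misses `Uᶜ`
    rw [Set.disjoint_left]
    rintro _ ⟨x, hx, rfl⟩ hU'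
    rw [hbandd] at hU'
    exact hU' (hmemU (circlePoint ((g (Af x)).1)) ((g (Af x)).2) ((hWest x hx).trans_le hρρU))
  · -- ### `K₁` meets the band exactly in the left edge line
    ext x
    constructor
    · rintro ⟨hmem, hx⟩
      refine ⟨hx, ?_⟩
      change band x ∈ range K₁ at hmem
      rw [hbandd] at hmem
      obtain ⟨t, ht, hEq⟩ := hsep₁ (circlePoint ((g (Af x)).1)) ((g (Af x)).2) ((hWest x hx).trans_le hρρ₁) hmem
      have hG := hG₁ t (ht.le.trans hτε₁)
      rw [← hG] at hEq
      obtain ⟨hc, hw⟩ := Prod.mk.inj (E.tubularMap_injective hEq)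
      obtain ⟨k, hk⟩ := exists_eq_add_of_circlePoint_eq hc
      -- `k = 0` and `|x 0| < 1/8`
      obtain ⟨⟨h01, h02⟩, -⟩ := hsq x hx
      have hφt := abs_le.1 (hφ₁b t)
      have hΦx := abs_le.1 (hΦest x)
      have hk0' : k = 0 := by
        refine hk0 k (x 0) (by linarith) h02 ?_
        rw [abs_lt]
        have e1 : (2 : ℝ) * k - x 0 = ((g (Af x)).1 - π * x 0 - φ₁ t) / π := by
          field_simp
          rw [hk]
          ring
        rw [e1]
        constructor
        · rw [lt_div_iff₀ hπ]; nlinarith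
        · rw [div_lt_iff₀ hπ]; nlinarith
      rw [hk0', Int.cast_zero, zero_mul, add_zero] at hk
      have hx0 : |x 0| < 1 / 8 := by
        rw [abs_lt]
        constructor <;> nlinarith [hk]
      have hb1 : β (x 0) = 1 := hβ1 _ (abs_lt.1 hx0).2.le
      have hb2 : β₂ (x 0) = 0 := hβ₂0 _ (by linarith [(abs_lt.1 hx0).2])
      have hW1 : (g (Af x)).2 = w₁ (yt x) := by
        rw [hWd, hb1, hb2]; simp
      have hΦ1 : (g (Af x)).1 = π * x 0 + φ₁ (yt x) := by
        rw [hΦd, hb1, hb2]; ring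
      -- `w₁` is injective near `0`: `yt x = t`
      have hyx : yt x = t := by
        have h1 : w₁ (yt x) = w₁ t := by rw [← hW1, hw]
        have hyI : yt x ∈ Icc (-ε₁) ε₁ :=
          ⟨by linarith [(abs_lt.1 (hyt x hx)).1], by linarith [(abs_lt.1 (hyt x hx)).2]⟩
        have htI : t ∈ Icc (-ε₁) ε₁ :=
          ⟨by linarith [(abs_lt.1 ht).1], by linarith [(abs_lt.1 ht).2]⟩
        exact hw₁inj hyI htI h1
      have : π * x 0 = 0 := by
        have := hk
        rw [hΦ1, hyx] at this
        linarith
      exact (mul_eq_zero.1 this).resolve_left hπ.ne'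
    · rintro ⟨hx, hx0⟩
      refine ⟨?_, hx⟩
      change band x ∈ range K₁
      have hx0' : x 0 = 0 := hx0
      have hb1 : β (x 0) = 1 := hβ1 _ (by rw [hx0']; norm_num)
      have hb2 : β₂ (x 0) = 0 := hβ₂0 _ (by rw [hx0']; norm_num)
      have hW1 : (g (Af x)).2 = w₁ (yt x) := by
        rw [hWd, hb1, hb2]; simp
      have hΦ1 : (g (Af x)).1 = φ₁ (yt x) := by
        rw [hΦd, hb1, hb2, hx0']; ring
      rw [hbandd, hΦ1, hW1, hG₁ _ ((hyt x hx).le.trans hκε₁.le)]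
      exact ⟨_, rfl⟩
  · -- ### `K₂` meets the band exactly in the right edge line
    ext x
    constructor
    · rintro ⟨hmem, hx⟩
      refine ⟨hx, ?_⟩
      change band x ∈ range K₂ at hmem
      rw [hbandd] at hmem
      obtain ⟨t, ht, hEq⟩ := hsep₂ (circlePoint ((g (Af x)).1)) ((g (Af x)).2) ((hWest x hx).trans_le hρρ₂) hmem
      have hG := hG₂ (-t) (by rw [abs_neg]; exact ht.le.trans hτε₂)
      rw [show θ₂ + -1 * -t = θ₂ + t by ring] at hG
      rw [← hG] at hEq
      obtain ⟨hc, hw⟩ := Prod.mk.inj (E.tubularMap_injective hEq)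
      obtain ⟨k, hk⟩ := exists_eq_add_of_circlePoint_eq hc
      obtain ⟨⟨h01, h02⟩, -⟩ := hsq x hx
      have hφt := abs_le.1 (hφ₂b (-t))
      have hΦx := abs_le.1 (hΦest x)
      have hk0' : k = 0 := by
        refine hk0 k (x 0 - 1) (by linarith) (by linarith) ?_
        rw [abs_lt]
        have e1 : (2 : ℝ) * k - (x 0 - 1) = ((g (Af x)).1 - π * x 0 - φ₂ (-t)) / π := by
          field_simp
          rw [hk]
          ring
        rw [e1]
        constructor
        · rw [lt_div_iff₀ hπ]; nlinarith
        · rw [div_lt_iff₀ hπ]; nlinarith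
      rw [hk0', Int.cast_zero, zero_mul, add_zero] at hk
      have hx0 : |x 0 - 1| < 1 / 8 := by
        rw [abs_lt]
        constructor <;> nlinarith [hk]
      have hb1 : β (x 0) = 0 := hβ0 _ (by linarith [(abs_lt.1 hx0).1])
      have hb2 : β₂ (x 0) = 1 := hβ₂1 _ (by linarith [(abs_lt.1 hx0).1])
      have hW1 : (g (Af x)).2 = w₂ (yt x) := by
        rw [hWd, hb1, hb2]; simp
      have hΦ1 : (g (Af x)).1 = π * x 0 + φ₂ (yt x) := by
        rw [hΦd, hb1, hb2]; ring
      have hyx : yt x = -t := by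
        have h1 : w₂ (yt x) = w₂ (-t) := by rw [← hW1, hw]
        have hyI : yt x ∈ Icc (-ε₂) ε₂ :=
          ⟨by linarith [(abs_lt.1 (hyt x hx)).1], by linarith [(abs_lt.1 (hyt x hx)).2]⟩
        have htI : -t ∈ Icc (-ε₂) ε₂ :=
          ⟨by linarith [(abs_lt.1 ht).2], by linarith [(abs_lt.1 ht).1]⟩
        exact hw₂inj hyI htI h1
      have : π * (x 0 - 1) = 0 := by
        have := hk
        rw [hΦ1, hyx] at this
        linarith
      have h2 := (mul_eq_zero.1 this).resolve_left hπ.ne'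
      linarith
    · rintro ⟨hx, hx0⟩
      refine ⟨?_, hx⟩
      change band x ∈ range K₂
      have hx0' : x 0 = 1 := hx0
      have hb1 : β (x 0) = 0 := hβ0 _ (by rw [hx0']; norm_num)
      have hb2 : β₂ (x 0) = 1 := hβ₂1 _ (by rw [hx0']; norm_num)
      have hW1 : (g (Af x)).2 = w₂ (yt x) := by
        rw [hWd, hb1, hb2]; simp
      have hΦ1 : (g (Af x)).1 = π + φ₂ (yt x) := by
        rw [hΦd, hb1, hb2, hx0']; ring
      rw [hbandd, hΦ1, hW1, hG₂ _ ((hyt x hx).le.trans hκε₂.le)]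
      exact ⟨_, rfl⟩
  · -- ### orientation along the left edge: `K₁` runs upwards
    refine ⟨θ₁, κ⁻¹, inv_pos.2 hκ, ?_, ?_⟩
    · rw [hedgeL' 2⁻¹ (by norm_num [hε₁.le])]
      norm_num
    · -- near `s = 1/2` the left edge line is `K₁ (circlePoint (θ₁ + κ (s - 1/2)))`
      have hev : (fun s : ℝ ↦ ((band (pt2 0 s) : 𝕊 3) : 𝔼 4)) =ᶠ[𝓝 (2⁻¹ : ℝ)]
          fun s ↦ SphereEmbedding.curve K₁ (θ₁ + κ * (s - 1 / 2)) := by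
        have ho : IsOpen {s : ℝ | |κ * (s - 1 / 2)| < ε₁} :=
          isOpen_lt (continuous_abs.comp (continuous_const.mul (continuous_id.sub continuous_const))) continuous_const
        have hmem : (2⁻¹ : ℝ) ∈ {s : ℝ | |κ * (s - 1 / 2)| < ε₁} := by
          change |κ * (2⁻¹ - 1 / 2)| < ε₁
          norm_num [hε₁]
        filter_upwards [ho.mem_nhds hmem] with s hs
        rw [hedgeL' s (le_of_lt hs), SphereEmbedding.curve_apply]
      have hder : deriv (fun s : ℝ ↦ ((band (pt2 0 s) : 𝕊 3) : 𝔼 4)) 2⁻¹ = κ • K₁.tangent θ₁ := by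
        rw [hev.deriv_eq]
        have h1 : HasDerivAt (fun s : ℝ ↦ θ₁ + κ * (s - 1 / 2)) κ 2⁻¹ := by
          exact ((((hasDerivAt_id (2⁻¹ : ℝ)).sub_const (1 / 2)).const_mul κ).const_add θ₁).congr_deriv
            (by ring)
        have h2 : HasDerivAt (SphereEmbedding.curve K₁ ∘ fun s : ℝ ↦ θ₁ + κ * (s - 1 / 2))
            (κ • K₁.tangent (θ₁ + κ * (2⁻¹ - 1 / 2))) 2⁻¹ :=
          (K₁.hasDerivAt_curve _).scomp 2⁻¹ h1
        have h3 : θ₁ + κ * (2⁻¹ - 1 / 2) = θ₁ := by norm_num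
        rw [h3] at h2
        exact h2.deriv
      have hdiff : DifferentiableAt ℝ (fun x ↦ ((band x : 𝕊 3) : 𝔼 4)) (pt2 0 2⁻¹) := by
        rw [hcoe']
        exact (E.differentiable_tubeδ E.tubularRadius).comp ((hgs.differentiable (by simp)).comp (hAfs.differentiable (by simp))) _
      have hfd : fderiv ℝ (fun x ↦ ((band x : 𝕊 3) : 𝔼 4)) (pt2 0 2⁻¹) (pt2 0 1) = κ • K₁.tangent θ₁ := by
        rw [fderiv_pt2_zero_one hdiff]
        exact hder
      have hlhs : deriv (fun t ↦ ((K₁ (circlePoint t) : 𝕊 3) : 𝔼 4)) θ₁ = K₁.tangent θ₁ := rfl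
      rw [hlhs, hfd, smul_smul, inv_mul_cancel₀ hκ.ne', one_smul]
  · -- ### orientation along the right edge: `K₂` runs downwards
    refine ⟨θ₂, κ⁻¹, inv_pos.2 hκ, ?_, ?_⟩
    · rw [hedgeR' 2⁻¹ (by norm_num [hε₂.le])]
      norm_num
    · have hev : (fun s : ℝ ↦ ((band (pt2 1 s) : 𝕊 3) : 𝔼 4)) =ᶠ[𝓝 (2⁻¹ : ℝ)]
          fun s ↦ SphereEmbedding.curve K₂ (θ₂ - κ * (s - 1 / 2)) := by
        have ho : IsOpen {s : ℝ | |κ * (s - 1 / 2)| < ε₂} :=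
          isOpen_lt (continuous_abs.comp (continuous_const.mul (continuous_id.sub continuous_const))) continuous_const
        have hmem : (2⁻¹ : ℝ) ∈ {s : ℝ | |κ * (s - 1 / 2)| < ε₂} := by
          change |κ * (2⁻¹ - 1 / 2)| < ε₂
          norm_num [hε₂]
        filter_upwards [ho.mem_nhds hmem] with s hs
        rw [hedgeR' s (le_of_lt hs), SphereEmbedding.curve_apply]
      have hder : deriv (fun s : ℝ ↦ ((band (pt2 1 s) : 𝕊 3) : 𝔼 4)) 2⁻¹ = (-κ) • K₂.tangent θ₂ := by
        rw [hev.deriv_eq]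
        have h1 : HasDerivAt (fun s : ℝ ↦ θ₂ - κ * (s - 1 / 2)) (-κ) 2⁻¹ := by
          exact ((((hasDerivAt_id (2⁻¹ : ℝ)).sub_const (1 / 2)).const_mul κ).const_sub θ₂).congr_deriv
            (by ring)
        have h2 : HasDerivAt (SphereEmbedding.curve K₂ ∘ fun s : ℝ ↦ θ₂ - κ * (s - 1 / 2))
            ((-κ) • K₂.tangent (θ₂ - κ * (2⁻¹ - 1 / 2))) 2⁻¹ :=
          (K₂.hasDerivAt_curve _).scomp 2⁻¹ h1
        have h3 : θ₂ - κ * (2⁻¹ - 1 / 2) = θ₂ := by norm_num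
        rw [h3] at h2
        exact h2.deriv
      have hdiff : DifferentiableAt ℝ (fun x ↦ ((band x : 𝕊 3) : 𝔼 4)) (pt2 1 2⁻¹) := by
        rw [hcoe']
        exact (E.differentiable_tubeδ E.tubularRadius).comp ((hgs.differentiable (by simp)).comp (hAfs.differentiable (by simp))) _
      have hfd : fderiv ℝ (fun x ↦ ((band x : 𝕊 3) : 𝔼 4)) (pt2 1 2⁻¹) (pt2 0 1) = (-κ) • K₂.tangent θ₂ := by
        rw [fderiv_pt2_zero_one hdiff]
        exact hder
      have hlhs : deriv (fun t ↦ ((K₂ (circlePoint t) : 𝕊 3) : 𝔼 4)) θ₂ = K₂.tangent θ₂ := rfl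
      rw [hlhs, pt2_zero_neg_one, map_neg, hfd, neg_smul, neg_neg, smul_smul,
        inv_mul_cancel₀ hκ.ne', one_smul]

end Knot

end Literature.Topology.FourManifolds
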